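import Mathlib
import Literature.Computability.AlgebraicComplexity.ValiantCriterion
import Literature.Computability.AlgebraicComplexity.ArithCircuitProofs
import Literature.Computability.AlgebraicComplexity.DefinableVNPWitness
import Literature.Computability.AlgebraicComplexity.BurgisserBooleanPartsModPCircuits
import Summits.ValiantsHypothesis.ValiantsHypothesis.Theorems.FeketeSOSSOSMagnificationStubCircuitSumIdentity

/-!
# Crux `FeketeSOS.SOSMagnification` (stmt-ValiantsHypothesis-3995), line `sml-polarised-transport`:
# the VNP half — assembly (stub C4, `stub_vnpAssembly`)

From a Legendre test circuit (C1), a one-hot/comparison circuit (C2) — both stated as hypotheses — and the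
landed reindexing identity C3 (`stub_circuitSumIdentity`), the one-hot base-`(n+1)` digit lift of the Fekete
polynomial `F_{p_n}` is a `VNP` family over `ℂ` (Bürgisser Def. 2.5 = `IsVNPFamily`), by the tree's PROVED
Valiant criterion machinery: `ValiantCriterion.witness/boolSum_witness/complexity_witness_le/
totalDegree_witness_le`, the `CktSize` calculus (`rewire/pair/comp/toCircuit`), projection bounds
(`IsProjection.complexity_le_holds`, `DefVNP.IsProjection.totalDegree_le_holds`) and Euler's criterion
(`legendreSym.eq_pow`).  Exceptional levels `n < 2` (where `p_n` is an arbitrary odd prime) use the empty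
Boolean sum of the member itself.
-/

noncomputable section

set_option linter.dupNamespace false

open MvPolynomial
open Literature.Computability.AlgebraicComplexity
open Literature.Computability.Complexity (CktSize B2 Circuit cktSize_and cktSize_mux)

namespace Summit.ValiantsHypothesis.ValiantsHypothesis.Theorems.FeketeSOSSOSMagnification

universe u v

/-! ### Generic pieces -/

/-- Level-wise assembly of a `VNP` family (Bürgisser 2000, Def. 2.5 bookkeeping): per-level Boolean-sum
witnesses with one p-bounded cost function give `IsVNPFamily`.  (Local copy; the registered helper
`isVNPFamily_of_levelwise` lands separately.) -/
theorem isVNPFamily_of_levelwise' {k : Type u} [CommSemiring k] {σ : ℕ → Type v} [∀ n, Fintype (σ n)]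
    {f : ∀ n, MvPolynomial (σ n) k} {B : ℕ → ℕ} (hf : IsPFamily f) (hB : IsPBounded B)
    (h : ∀ n, ∃ (r : ℕ) (g : MvPolynomial (σ n ⊕ Fin r) k),
      boolSum g = f n ∧ r ≤ B n ∧ complexity g ≤ B n ∧ g.totalDegree ≤ B n) :
    IsVNPFamily f := by
  choose u g hsum hu hcx hdeg using h
  refine ⟨hf, u, g, ⟨⟨?_, IsPBounded.mono hB hdeg⟩, IsPBounded.mono hB hcx⟩, fun n => (hsum n).symm⟩
  refine IsPBounded.mono (IsPBounded.add_holds hf.1 hB) fun n => ?_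
  rw [Fintype.card_sum, Fintype.card_fin]
  exact Nat.add_le_add_left (hu n) _

/-- The empty Boolean sum of `rename inl f` is `f` (the `u = 0` witness). -/
theorem boolSum_rename_inl {τ : Type*} (f : MvPolynomial τ ℂ) :
    boolSum (m := 0) (rename Sum.inl f) = f := by
  unfold boolSum
  have h : ∀ e : Fin 0 → Bool,
      aeval (Sum.elim X fun j => if e j then (1 : MvPolynomial τ ℂ) else 0) (rename Sum.inl f) = f := by
    intro e
    rw [aeval_rename]
    exact aeval_X_left_apply f
  simp only [h, Finset.sum_const, Finset.card_univ]
  rw [show Fintype.card (Fin 0 → Bool) = 1 by simp, one_smul]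

/-- Valiant's Boolean sum commutes with a substitution of the genuine variables (the Boolean variables being
left alone): `Σ_e (G(a, e)) = (Σ_e G(X, e))(a)`. -/
theorem boolSum_aeval_sumElim {σ τ : Type*} {m : ℕ} (a : τ → MvPolynomial σ ℂ)
    (G : MvPolynomial (τ ⊕ Fin m) ℂ) :
    boolSum (aeval (Sum.elim (fun t => rename Sum.inl (a t)) (fun j => X (Sum.inr j))) G) =
      aeval a (boolSum G) := by
  simp only [boolSum, map_sum]
  refine Finset.sum_congr rfl fun e _ => ?_
  rw [← AlgHom.comp_apply, ← AlgHom.comp_apply, MvPolynomial.comp_aeval, MvPolynomial.comp_aeval]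
  refine congrArg (fun φ : τ ⊕ Fin m → MvPolynomial σ ℂ => aeval φ G) ?_
  funext x
  rcases x with t | j
  · have h1 : aeval (Sum.elim X fun j => if e j = true then (1 : MvPolynomial σ ℂ) else 0)
        (rename Sum.inl (a t)) = a t := by
      rw [aeval_rename]
      exact aeval_X_left_apply (a t)
    simp only [Sum.elim_inl, aeval_X, h1]
  · simp only [Sum.elim_inr, aeval_X]
    split_ifs <;> simp

/-- **From a `B₂`-circuit to a projected Boolean-sum witness** (Valiant's criterion, Bürgisser 2000 Prop. 2.20,
plus closure under projections): for a circuit `Q` on `M` inputs and a substitution `a` of its variables by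
variables or constants, the projected circuit-sum `(Σ_e [Q e] X^e)(a)` is the Boolean sum of a polynomial in
`M + |Q|` Boolean variables of complexity `≤ 60|Q| + 5M + 2` and degree `≤ 3|Q| + 1 + 2M`. -/
theorem exists_boolSum_proj_circuitSum {σ : Type*} {M : ℕ} (Q : Circuit (Fin M)) (hQ : Q.IsOver B2)
    (a : Fin M → MvPolynomial σ ℂ) (ha : ∀ t, (∃ v, a t = X v) ∨ ∃ c, a t = C c) :
    ∃ g : MvPolynomial (σ ⊕ Fin (M + Q.size)) ℂ,
      boolSum g = aeval a (ValiantCriterion.circuitSum (k := ℂ) Q) ∧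
      complexity g ≤ 60 * Q.size + 5 * M + 2 ∧ g.totalDegree ≤ 3 * Q.size + 1 + 2 * M := by
  let s : Fin M ⊕ Fin (M + Q.size) → MvPolynomial (σ ⊕ Fin (M + Q.size)) ℂ :=
    Sum.elim (fun t => rename Sum.inl (a t)) (fun j => X (Sum.inr j))
  have hproj : IsProjection (aeval s (ValiantCriterion.witness (k := ℂ) Q))
      (ValiantCriterion.witness (k := ℂ) Q) := by
    refine ⟨s, ?_, rfl⟩
    rintro (t | j)
    · rcases ha t with ⟨v, hv⟩ | ⟨c, hc⟩
      · exact Or.inl ⟨Sum.inl v, by simp [s, hv]⟩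
      · exact Or.inr ⟨c, by simp [s, hc]⟩
    · exact Or.inl ⟨Sum.inr j, by simp [s]⟩
  refine ⟨aeval s (ValiantCriterion.witness (k := ℂ) Q), ?_, ?_, ?_⟩
  · rw [boolSum_aeval_sumElim, ValiantCriterion.boolSum_witness Q hQ]
  · exact (IsProjection.complexity_le_holds hproj).trans (ValiantCriterion.complexity_witness_le Q)
  · exact (DefVNP.IsProjection.totalDegree_le_holds hproj).trans (ValiantCriterion.totalDegree_witness_le Q)

/-- **Euler's criterion, test form**: for an odd prime `p`, `m^{(p-1)/2} = ±1 (mod p)` iff `(m|p) = ±1`. -/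
theorem pow_half_eq_iff_legendreSym {p : ℕ} [Fact p.Prime] (hp2 : p ≠ 2) (m : ℕ) (b : Bool) :
    ((m : ZMod p) ^ (p / 2) = if b then (-1 : ZMod p) else 1) ↔
      (legendreSym p m = if b then -1 else 1) := by
  haveI : Fact (2 < p) := ⟨lt_of_le_of_ne (Fact.out : p.Prime).two_le (Ne.symm hp2)⟩
  have key : ((legendreSym p m : ℤ) : ZMod p) = (m : ZMod p) ^ (p / 2) := by
    rw [legendreSym.eq_pow]; push_cast; rfl
  rw [← key]
  have hL : legendreSym p m = 0 ∨ legendreSym p m = 1 ∨ legendreSym p m = -1 := by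
    by_cases h0 : ((m : ℤ) : ZMod p) = 0
    · exact Or.inl ((legendreSym.eq_zero_iff p m).2 h0)
    · exact Or.inr (legendreSym.eq_one_or_neg_one p h0)
  have h1 : (1 : ZMod p) ≠ -1 := fun h => ZMod.neg_one_ne_one h.symm
  have h2 : (0 : ZMod p) ≠ 1 := zero_ne_one
  have h3 : (0 : ZMod p) ≠ -1 := fun h => one_ne_zero (neg_eq_zero.1 h.symm)
  rcases hL with h | h | h <;> cases b <;> simp [h, h1, h2, h3, h1.symm]

/-- Complexity of the digit lift by brute force: `p` summands, each a constant times `n` variables. -/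
theorem complexity_fekDigit_le (k : ℕ) [NeZero k] (p : ℕ) [Fact p.Prime] (n : ℕ) :
    complexity (∑ m ∈ Finset.range p, C ((legendreSym p m : ℤ) : ℂ) *
        ∏ j : Fin n, X (j, (⟨m / k ^ (j : ℕ) % k, Nat.mod_lt _ (Nat.pos_of_neZero k)⟩ : Fin k)) :
          MvPolynomial (Fin n × Fin k) ℂ) ≤ p * (n + 2) := by
  refine (complexity_finset_sum_le _ _).trans ?_
  rw [Finset.card_range]
  have hterm : ∀ m ∈ Finset.range p, complexity (C ((legendreSym p m : ℤ) : ℂ) *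
      ∏ j : Fin n, X (j, (⟨m / k ^ (j : ℕ) % k, Nat.mod_lt _ (Nat.pos_of_neZero k)⟩ : Fin k)) :
        MvPolynomial (Fin n × Fin k) ℂ) ≤ n + 1 := by
    intro m _
    refine (complexity_mul_le_holds _ _).trans ?_
    have hp := complexity_finset_prod_le (Finset.univ : Finset (Fin n))
      (fun j => (X (j, (⟨m / k ^ (j : ℕ) % k, Nat.mod_lt _ (Nat.pos_of_neZero k)⟩ : Fin k)) :
        MvPolynomial (Fin n × Fin k) ℂ))
    rw [Finset.sum_eq_zero (fun j _ => complexity_X_holds _), Finset.card_univ, Fintype.card_fin,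
      zero_add] at hp
    rw [complexity_C_holds]
    omega
  calc _ ≤ (∑ _m ∈ Finset.range p, (n + 1)) + p := Nat.add_le_add_right (Finset.sum_le_sum hterm) _
    _ = p * (n + 2) := by rw [Finset.sum_const, Finset.card_range, smul_eq_mul]; ring

/-- The digit lift has degree `≤ n`. -/
theorem totalDegree_fekDigit_le (k : ℕ) [NeZero k] (p : ℕ) [Fact p.Prime] (n : ℕ) :
    (∑ m ∈ Finset.range p, C ((legendreSym p m : ℤ) : ℂ) *
        ∏ j : Fin n, X (j, (⟨m / k ^ (j : ℕ) % k, Nat.mod_lt _ (Nat.pos_of_neZero k)⟩ : Fin k)) :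
          MvPolynomial (Fin n × Fin k) ℂ).totalDegree ≤ n := by
  refine (totalDegree_finsetSum _ _).trans (Finset.sup_le fun m _ => ?_)
  refine (totalDegree_mul _ _).trans ?_
  rw [totalDegree_C, zero_add]
  refine (totalDegree_finsetProd _ _).trans ?_
  calc _ ≤ ∑ _j : Fin n, 1 := Finset.sum_le_sum fun j _ => (totalDegree_X _).le
    _ = n := by simp

/-! ### One level: circuits C1 + C2 ⇒ a Boolean-sum witness of the digit lift -/

/-- **One level of the family.** Given the Legendre test circuit (C1) and the one-hot/comparison circuit
(C2) at `(k, n, ℓ, p)` with `p < k^n` odd and `p ≤ 2^ℓ`, the digit lift `Fek_{k,p,n}` is the Boolean sum of a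
polynomial with `≤ 64·(s₂ + s₁ + nk + 7)` Boolean variables, complexity and degree, `s₁, s₂` the two circuit
sizes: combine the circuits with one sign wire, package (`CktSize.toCircuit`), take Valiant's witness projected by
`X_t ↦ X_{(j,i)}`, `X_sign ↦ −1`, and identify its Boolean sum with the lift by C3 and Euler's criterion. -/
theorem level_witness {c₁ c₂ : ℕ}
    (hC1 : ∀ (k n ℓ p : ℕ) [Fact p.Prime], 2 ≤ k → 1 ≤ n → p ≤ 2 ^ ℓ →
      ∃ F : ((Fin n × Fin k) → Bool) → Bool → Bool,
        CktSize B2 F (c₁ * ((n + 1) * (k + 1) * (ℓ + 1)) ^ c₁) ∧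
        ∀ (d : Fin n → Fin k) (b : Bool),
          F (fun v => decide (d v.1 = v.2)) b =
            decide ((((∑ j : Fin n, (d j : ℕ) * k ^ (j : ℕ) : ℕ) : ZMod p) ^ (p / 2)) =
              if b then (-1 : ZMod p) else 1))
    (hC2 : ∀ (k n p : ℕ), 2 ≤ k → 1 ≤ n → p < k ^ n →
      ∃ G : ((Fin n × Fin k) → Bool) → Unit → Bool,
        CktSize B2 G (c₂ * ((n + 1) * (k + 1)) ^ c₂) ∧
        (∀ x, G x () = true → ∃ d : Fin n → Fin k, x = fun v => decide (d v.1 = v.2)) ∧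
        ∀ d : Fin n → Fin k, G (fun v => decide (d v.1 = v.2)) () =
          decide (∑ j : Fin n, (d j : ℕ) * k ^ (j : ℕ) < p))
    (k : ℕ) [NeZero k] (n p : ℕ) [Fact p.Prime] (hp2 : p ≠ 2) (hk : 2 ≤ k) (hn : 1 ≤ n)
    (hpk : p < k ^ n) (ℓ : ℕ) (hℓ : p ≤ 2 ^ ℓ) :
    ∃ (r : ℕ) (g : MvPolynomial ((Fin n × Fin k) ⊕ Fin r) ℂ),
      boolSum g = (∑ m ∈ Finset.range p, C ((legendreSym p m : ℤ) : ℂ) *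
        ∏ j : Fin n, X (j, (⟨m / k ^ (j : ℕ) % k, Nat.mod_lt _ (Nat.pos_of_neZero k)⟩ : Fin k)) :
          MvPolynomial (Fin n × Fin k) ℂ) ∧
      r ≤ 64 * (c₂ * ((n + 1) * (k + 1)) ^ c₂ + c₁ * ((n + 1) * (k + 1) * (ℓ + 1)) ^ c₁ + n * k + 7) ∧
      complexity g ≤
        64 * (c₂ * ((n + 1) * (k + 1)) ^ c₂ + c₁ * ((n + 1) * (k + 1) * (ℓ + 1)) ^ c₁ + n * k + 7) ∧
      g.totalDegree ≤
        64 * (c₂ * ((n + 1) * (k + 1)) ^ c₂ + c₁ * ((n + 1) * (k + 1) * (ℓ + 1)) ^ c₁ + n * k + 7) := by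
  classical
  obtain ⟨F, hFsz, hFspec⟩ := hC1 k n ℓ p hk hn hℓ
  obtain ⟨G, hGsz, hGoh, hGspec⟩ := hC2 k n p hk hn hpk
  -- sizes as atoms
  set sF := c₁ * ((n + 1) * (k + 1) * (ℓ + 1)) ^ c₁ with hsF
  set sG := c₂ * ((n + 1) * (k + 1)) ^ c₂ with hsG
  -- (1) the combined circuit `H (x, σ) = G x ∧ F x σ` on `α ⊕ Unit`
  let H : ((Fin n × Fin k) ⊕ Unit → Bool) → Unit → Bool := fun y _ =>
    G (fun v => y (Sum.inl v)) () && F (fun v => y (Sum.inl v)) (y (Sum.inr ()))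
  have hH : CktSize B2 H (sG + sF + 0 + (0 + 4) + 1) := by
    have h2 := ((hGsz.rewire Sum.inl).pair (hFsz.rewire Sum.inl)).pair
      (Literature.Computability.Complexity.CktSize.proj B2
        (fun _ : Unit => (Sum.inr () : (Fin n × Fin k) ⊕ Unit)))
    have h3 : CktSize B2 (fun (w : (Unit ⊕ Bool) ⊕ Unit → Bool) =>
        Sum.elim (fun _ : Unit => w (Sum.inl (Sum.inl ())))
          (fun _ : Unit => (w (Sum.inr ()) && w (Sum.inl (Sum.inr true)) ||
            !w (Sum.inr ()) && w (Sum.inl (Sum.inr false))))) (0 + 4) :=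
      (Literature.Computability.Complexity.CktSize.proj B2
        (fun _ : Unit => (Sum.inl (Sum.inl ()) : (Unit ⊕ Bool) ⊕ Unit))).pair (cktSize_mux _ _ _)
    have h4 : CktSize B2 (fun (u : Unit ⊕ Unit → Bool) (_ : Unit) => (u (Sum.inl ()) && u (Sum.inr ())))
        1 := cktSize_and _ _
    refine ((h2.comp h3).comp h4).congr fun y u => ?_
    cases hb : y (Sum.inr ()) <;> simp [H, hb]
  -- (2) transport to `Fin (n k + 1)` and package as a `Circuit`
  let ε : (Fin n × Fin k) ⊕ Unit ≃ Fin (n * k + 1) :=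
    (Equiv.sumCongr finProdFinEquiv finOneEquiv.symm).trans finSumFinEquiv
  obtain ⟨Q, hQB2, hQsize, hQeval⟩ := (hH.rewire ε).toCircuit
  -- (3) the projection `X_t ↦ X_v` (`t = ε (inl v)`), `X_{ε (inr ())} ↦ -1`
  let a : Fin (n * k + 1) → MvPolynomial (Fin n × Fin k) ℂ := fun t =>
    Sum.elim (fun v => X v) (fun _ => C (-1 : ℂ)) (ε.symm t)
  have ha : ∀ t, (∃ v, a t = X v) ∨ ∃ c, a t = C c := by
    intro t
    simp only [a]
    rcases ε.symm t with v | u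
    · exact Or.inl ⟨v, rfl⟩
    · exact Or.inr ⟨-1, rfl⟩
  obtain ⟨g, hgsum, hgcx, hgdeg⟩ := exists_boolSum_proj_circuitSum Q hQB2 a ha
  refine ⟨n * k + 1 + Q.size, g, ?_, ?_, ?_, ?_⟩
  · -- the identity `boolSum g = Fek`
    rw [hgsum]
    unfold ValiantCriterion.circuitSum
    rw [map_sum]
    have hterm : ∀ e : Fin (n * k + 1) → Bool,
        aeval a (C (CircuitArith.toK ℂ (Q.eval e)) * ∏ t, (if e t then X t else 1)) =
          (if H (fun w => e (ε w)) () then (1 : MvPolynomial (Fin n × Fin k) ℂ) else 0) *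
            ∏ t, (if e t then a t else 1) := by
      intro e
      rw [map_mul, map_prod, MvPolynomial.aeval_C, MvPolynomial.algebraMap_eq, hQeval]
      congr 1
      · cases H (fun w => e (ε w)) () <;> simp [CircuitArith.toK]
      · refine Finset.prod_congr rfl fun t _ => ?_
        split_ifs <;> simp
    rw [Finset.sum_congr rfl fun e _ => hterm e]
    -- reindex the assignments along `ε`
    rw [← Equiv.sum_comp (ε.arrowCongr (Equiv.refl Bool))]
    have hre : ∀ y : (Fin n × Fin k) ⊕ Unit → Bool,
        (if H (fun w => (ε.arrowCongr (Equiv.refl Bool) y) (ε w)) () then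
            (1 : MvPolynomial (Fin n × Fin k) ℂ) else 0) *
          ∏ t, (if (ε.arrowCongr (Equiv.refl Bool) y) t then a t else 1) =
        (if G (fun v => y (Sum.inl v)) () && F (fun v => y (Sum.inl v)) (y (Sum.inr ())) then
            (1 : MvPolynomial (Fin n × Fin k) ℂ) else 0) *
          ((∏ v : Fin n × Fin k, if y (Sum.inl v) then (X v : MvPolynomial (Fin n × Fin k) ℂ) else 1) *
            (if y (Sum.inr ()) then (-1 : MvPolynomial (Fin n × Fin k) ℂ) else 1)) := by
      intro y
      have hy : (fun w => (ε.arrowCongr (Equiv.refl Bool) y) (ε w)) = y := by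
        funext w; simp [Equiv.arrowCongr_apply]
      rw [hy]
      congr 1
      rw [← Equiv.prod_comp ε, Fintype.prod_sum_type]
      congr 1
      · refine Finset.prod_congr rfl fun v _ => ?_
        simp [a, Equiv.arrowCongr_apply]
      · rw [Fintype.prod_unique]
        simp [a, Equiv.arrowCongr_apply, map_neg]
    rw [Finset.sum_congr rfl fun y _ => hre y]
    -- split the assignments into `(x, b)`
    rw [← Equiv.sum_comp (Equiv.sumArrowEquivProdArrow (Fin n × Fin k) Unit Bool).symm,
      Fintype.sum_prod_type]
    simp only [Equiv.sumArrowEquivProdArrow_symm_apply_inl, Equiv.sumArrowEquivProdArrow_symm_apply_inr]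
    rw [Finset.sum_congr rfl fun x _ => (Equiv.sum_comp (Equiv.funUnique Unit Bool).symm
      (fun ub : Unit → Bool => (if G (fun v => x v) () && F (fun v => x v) (ub ()) then
          (1 : MvPolynomial (Fin n × Fin k) ℂ) else 0) *
        ((∏ v : Fin n × Fin k, if x v then (X v : MvPolynomial (Fin n × Fin k) ℂ) else 1) *
          (if ub () then (-1 : MvPolynomial (Fin n × Fin k) ℂ) else 1)))).symm]
    simp only [Equiv.funUnique_symm_apply]
    -- C3
    refine stub_circuitSumIdentity k n p hpk.le (fun x b => G x () && F x b) ?_ ?_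
    · intro x b hxb
      rw [Bool.and_eq_true] at hxb
      exact hGoh x hxb.1
    · intro d b
      rw [Bool.and_eq_true, hGspec, hFspec, decide_eq_true_eq, decide_eq_true_eq,
        pow_half_eq_iff_legendreSym hp2]
  · -- number of Boolean variables
    have hs : Q.size ≤ sG + sF + 5 := hQsize.trans (by omega)
    nlinarith [hs, Nat.zero_le (n * k)]
  · have hs : Q.size ≤ sG + sF + 5 := hQsize.trans (by omega)
    nlinarith [hs, hgcx, Nat.zero_le (n * k)]
  · have hs : Q.size ≤ sG + sF + 5 := hQsize.trans (by omega)
    nlinarith [hs, hgdeg, Nat.zero_le (n * k)]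

/-! ### The family: radix `n + 1`, odd primes `p_n ≤ (n+1)^n` for `n ≥ 2` -/

/-- A prime is not a perfect `n`-th power for `n ≥ 2`. -/
theorem prime_lt_pow_of_le {p a n : ℕ} (hp : p.Prime) (hn : 2 ≤ n) (h : p ≤ a ^ n) : p < a ^ n := by
  refine lt_of_le_of_ne h fun he => ?_
  have := (hp.pow_eq_iff.1 he.symm).2
  omega

/-- **The VNP half of the line (registered stub C4 = `stub_vnpAssembly`).**  From the Legendre test circuit
(C1) and the one-hot/comparison circuit (C2), for every selector of odd primes with `p_n ≤ (n+1)^n` (`n ≥ 2`)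
the radix-`(n+1)` digit lift `(Fek_{n+1, p_n, n})_n` is a `VNP` family over `ℂ` (Bürgisser 2000, Def. 2.5 /
Prop. 2.20).  Levels `n ≥ 2`: `level_witness` with `ℓ = n·n` (`p_n ≤ (n+1)^n ≤ 2^{n²}`); levels `n < 2`: the
empty Boolean sum of the member itself (`complexity ≤ 3 p_n`), absorbed in the p-bound's constant. -/
theorem stub_vnpAssembly
    (hC1 : ∃ c : ℕ, ∀ (k n ℓ p : ℕ) [Fact p.Prime], 2 ≤ k → 1 ≤ n → p ≤ 2 ^ ℓ →
      ∃ F : ((Fin n × Fin k) → Bool) → Bool → Bool,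
        CktSize B2 F (c * ((n + 1) * (k + 1) * (ℓ + 1)) ^ c) ∧
        ∀ (d : Fin n → Fin k) (b : Bool),
          F (fun v => decide (d v.1 = v.2)) b =
            decide ((((∑ j : Fin n, (d j : ℕ) * k ^ (j : ℕ) : ℕ) : ZMod p) ^ (p / 2)) =
              if b then (-1 : ZMod p) else 1))
    (hC2 : ∃ c : ℕ, ∀ (k n p : ℕ), 2 ≤ k → 1 ≤ n → p < k ^ n →
      ∃ G : ((Fin n × Fin k) → Bool) → Unit → Bool,
        CktSize B2 G (c * ((n + 1) * (k + 1)) ^ c) ∧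
        (∀ x, G x () = true → ∃ d : Fin n → Fin k, x = fun v => decide (d v.1 = v.2)) ∧
        ∀ d : Fin n → Fin k, G (fun v => decide (d v.1 = v.2)) () =
          decide (∑ j : Fin n, (d j : ℕ) * k ^ (j : ℕ) < p))
    (pSel : ℕ → ℕ) [∀ n, Fact (pSel n).Prime] (hodd : ∀ n, pSel n ≠ 2)
    (hle : ∀ n, 2 ≤ n → pSel n ≤ (n + 1) ^ n) :
    @IsVNPFamily ℂ _ (fun n => Fin n × Fin (n + 1)) _
      (fun n => ∑ m ∈ Finset.range (pSel n), C ((legendreSym (pSel n) m : ℤ) : ℂ) *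
        ∏ j : Fin n, X (j, (⟨m / (n + 1) ^ (j : ℕ) % (n + 1),
          Nat.mod_lt _ (Nat.pos_of_neZero (n + 1))⟩ : Fin (n + 1)))) := by
  classical
  obtain ⟨c₁, hc₁⟩ := hC1
  obtain ⟨c₂, hc₂⟩ := hC2
  -- p-family
  have hPF : @IsPFamily ℂ _ (fun n => Fin n × Fin (n + 1)) _
      (fun n => ∑ m ∈ Finset.range (pSel n), C ((legendreSym (pSel n) m : ℤ) : ℂ) *
        ∏ j : Fin n, X (j, (⟨m / (n + 1) ^ (j : ℕ) % (n + 1),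
          Nat.mod_lt _ (Nat.pos_of_neZero (n + 1))⟩ : Fin (n + 1)))) := by
    refine ⟨?_, IsPBounded.mono IsPBounded.id fun n => totalDegree_fekDigit_le (n + 1) (pSel n) n⟩
    have h1 : IsPBounded (fun n : ℕ => n + 1) := IsPBounded.add_holds IsPBounded.id (IsPBounded.const 1)
    refine IsPBounded.mono (IsPBounded.mul_holds IsPBounded.id h1) fun n => ?_
    simp
  -- the cost function
  have hP : IsPBounded (fun n : ℕ => (n + 1) * (n + 1 + 1)) :=
    IsPBounded.mul_holds (IsPBounded.add_holds IsPBounded.id (IsPBounded.const 1))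
      (IsPBounded.add_holds (IsPBounded.add_holds IsPBounded.id (IsPBounded.const 1)) (IsPBounded.const 1))
  have hP' : IsPBounded (fun n : ℕ => (n + 1) * (n + 1 + 1) * (n * n + 1)) :=
    IsPBounded.mul_holds hP (IsPBounded.add_holds (IsPBounded.mul_holds IsPBounded.id IsPBounded.id)
      (IsPBounded.const 1))
  have hS : IsPBounded (fun n : ℕ => 64 * (c₂ * ((n + 1) * (n + 1 + 1)) ^ c₂ +
      c₁ * ((n + 1) * (n + 1 + 1) * (n * n + 1)) ^ c₁ + n * (n + 1) + 7)) := by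
    refine IsPBounded.mul_holds (IsPBounded.const 64) ?_
    refine IsPBounded.add_holds (IsPBounded.add_holds (IsPBounded.add_holds ?_ ?_) ?_) (IsPBounded.const 7)
    · exact IsPBounded.mul_holds (IsPBounded.const c₂) (IsPBounded.pow_holds hP c₂)
    · exact IsPBounded.mul_holds (IsPBounded.const c₁) (IsPBounded.pow_holds hP' c₁)
    · exact IsPBounded.mul_holds IsPBounded.id (IsPBounded.add_holds IsPBounded.id (IsPBounded.const 1))
  have hB : IsPBounded (fun n : ℕ => pSel 0 * 2 + pSel 1 * 3 + 1 +
      64 * (c₂ * ((n + 1) * (n + 1 + 1)) ^ c₂ +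
        c₁ * ((n + 1) * (n + 1 + 1) * (n * n + 1)) ^ c₁ + n * (n + 1) + 7)) :=
    IsPBounded.add_holds (IsPBounded.const _) hS
  refine isVNPFamily_of_levelwise' hPF hB fun n => ?_
  by_cases hn : 2 ≤ n
  · -- circuit levels
    have hpk : pSel n < (n + 1) ^ n := prime_lt_pow_of_le (Fact.out) hn (hle n hn)
    have hℓ : pSel n ≤ 2 ^ (n * n) := by
      calc pSel n ≤ (n + 1) ^ n := hle n hn
        _ ≤ (2 ^ n) ^ n := Nat.pow_le_pow_left (Nat.lt_two_pow_self) n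
        _ = 2 ^ (n * n) := by rw [← pow_mul]
    obtain ⟨r, g, h1, h2, h3, h4⟩ :=
      level_witness hc₁ hc₂ (n + 1) n (pSel n) (hodd n) (by omega) (by omega) hpk (n * n) hℓ
    exact ⟨r, g, h1, h2.trans (Nat.le_add_left _ _), h3.trans (Nat.le_add_left _ _),
      h4.trans (Nat.le_add_left _ _)⟩
  · -- levels 0 and 1: the empty Boolean sum of the member
    refine ⟨0, rename Sum.inl _, boolSum_rename_inl _, Nat.zero_le _, ?_, ?_⟩
    · refine (complexity_rename_le_holds' _ _).trans
        ((complexity_fekDigit_le (n + 1) (pSel n) n).trans ?_)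
      interval_cases n <;> simp <;> omega
    · refine (totalDegree_rename_le _ _).trans ((totalDegree_fekDigit_le (n + 1) (pSel n) n).trans ?_)
      omega

end Summit.ValiantsHypothesis.ValiantsHypothesis.Theorems.FeketeSOSSOSMagnification

end
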